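import Summits.ResolutionOfSingularities.ResolutionOfSingularities.Theorems.DeltaCutCertificates
import Summits.ResolutionOfSingularities.ResolutionOfSingularities.Theorems.HistoryCutCells
import HarnessLib

/-!
# DeltaCutJunction — decomp-res node «DeltaCut» (lens-6 g23, critic row 181 CLEARED DECIDED +1 · MAP +1 (lane (b))),
tree file 8/8 of the node

Content VERBATIM from the decomp-res lens-6 g23 node `HOME/decomp-res-lens-6/g23/DeltaCut.lean` (pin a85f83d5) /
`DeltaCutJ.lean` (9b3a0295); imports the
landed tree only, carries nothing; HOME = run/shared/lean/pub/decomp-res; critic row 181 CLEARED DECIDED +1 · MAP +1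
(lane (b)); landing orders NODE-g23.md §10 /
INBOX :883 — provenance, critic text and the lens header in full in the first file of the node, `DeltaCutLaw`.
Namespace `…Theorems.DeltaCutClasses`;
`--supports stmt-ResolutionOfSingularities-26971`; cone-free.

## This file

§Junction (g23 · MAP (b), `DeltaCutJ` 9b3a0295 l. 1664–1793; 14 theorems, 0 defs) — FORCED TOWERS LIVE INSIDE THE
δ-HEAVY RESIDUAL LOCUS: the kernel junction between THIS column's located residual («a near point exists»:
`TopDeltaHeavy`, `WORTopDeltaHeavy n` / `E1TopDeltaHeavy`) and lens-4's forced-tower residuals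
(`HugValuationCut.NoTowerWild n P`; in the tree `HugValuationCut.NoWildFreshJumpShallowCompanionKangarooTowers`,
file `HistoryCutCells`): in a forced tower every marked point HAS a near point — the next marked point
(`tower_not_noNearPointOver`) — so by the three exclusion laws (twist, light, δ) NO stage of a forced tower over
base data is split, light or δ-light (`tower_stage_not_deltaLightAt`), every absolutely-contact-free stage lies in
`TopDeltaHeavy` (`tower_stage_topDeltaHeavy`, `tower_stage_topDeltaHeavy_of_pPowerTower`); PORT-FREE, HYP-FREE
`noTowerWild_iff_deltaHeavy` (the δ-LIGHT column of EVERY tower class is EMPTY), `E1TopDeltaHeavy → NoTowerWild n P`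
(∀ `P ≤ PPowerTower n`) modulo lens-4's own `TowerObstructs` (`noTowerWild_of_e1TopDeltaHeavy`,
`towerObstructs_of_towerObstructsAll`).

[WRITER NOTE (decomp-res writer g11): file split only (tree files ≤ 400 lines); `noncomputable section`, universe,
namespace, sections, section
variables, the `open` lines and every declaration exactly as in the lens; no instance, no notation, no include/omit added.]

(Sources: Hironaka1967 (characteristic polyhedra); CossartJannsenSaito2020 Def. 3.13 / Thm. 3.14 p. 129, Ch. 8 pp.
128–135, Thm. 9.6 p. 136; Hironaka1970 (near points / vertices); CossartPiltant2008 §2; Giraud1975; EGAIV4 §16–§17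
(formal smoothness); StacksProject 0804 / 0BIQ / 031I; Matsumura1987 §28.)
-/

noncomputable section

open CategoryTheory CategoryTheory.Limits AlgebraicGeometry TopologicalSpace IsLocalRing
open Literature.AlgebraicGeometry.Resolution
universe u

open Summit.ResolutionOfSingularities.ResolutionOfSingularities.Theorems.TwistCutClasses
open Summit.ResolutionOfSingularities.ResolutionOfSingularities.Theorems.LightCutClasses

namespace Summit.ResolutionOfSingularities.ResolutionOfSingularities.Theorems.DeltaCutClasses

section Junction

open Summit.ResolutionOfSingularities.ResolutionOfSingularities.Theorems
open WeakOrderReduction ForcedTowerClasses SubfieldContactClasses AbsoluteContactClasses PurityValveClasses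
open HugValuationCut
variable {K : Type} [Field K]

/-! ## §Junction (g23 · MAP (b)) — FORCED TOWERS LIVE INSIDE THE δ-HEAVY RESIDUAL LOCUS

The kernel junction between THIS column's located residual («a near point exists»: the locus `TopDeltaHeavy`, the cells
`WORTopDeltaHeavy n` / `E1TopDeltaHeavy`) and lens-4's forced-tower residuals (`HugValuationCut.NoTowerWild n P`; today, in
the tree, `HugValuationCut.NoWildFreshJumpShallowCompanionKangarooTowers`, file `HistoryCutCells`).  In a forced tower every
marked point `x_j` HAS a near point — the next marked point `x_{j+1}` (`tower_not_noNearPointOver`) — so by the three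
exclusion laws (twist `noNearPointOver_of_diffSplitAt`, light `noNearPointOver_of_lightAt`, δ `noNearPointOver_of_deltaLightAt`)
NO stage of a forced tower over base data is split, light or δ-light (`tower_stage_not_deltaLightAt`), and every
absolutely-contact-free stage lies in `TopDeltaHeavy` (`tower_stage_topDeltaHeavy`, `tower_stage_topDeltaHeavy_of_pPowerTower`).
Consequences.  (1) PORT-FREE, HYPOTHESIS-FREE: the δ-LIGHT column of EVERY tower class is EMPTY
(`noTowerWild_deltaLight_holds`) and every class equals its everywhere-δ-heavy part — an EXACT kernel `↔`
(`noTowerWild_iff_deltaHeavy`): lens-4's residual towers run ENTIRELY inside this column's residual locus, at every stage.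
(2) Modulo the tree's port `ForcedTowerClasses.TowerObstructs n` («a datum carrying an infinite forced tower has no weak
resolution», counted 0 in the tree), THIS COLUMN'S RESIDUAL IMPLIES EVERY WILD TOWER RESIDUAL:
`WORTopDeltaHeavy n → NoTowerWild n P` for every class `P ≤ PPowerTower n` or `P ≤ ContactFreeTower n`
(`noTowerWild_of_worTopDeltaHeavy`, `noTowerWild_of_worTopDeltaHeavy_contactFree`), by name
`E1TopDeltaHeavy → NoWildFreshJumpShallowCompanionKangarooTowers`
(`noWildFreshJumpShallowCompanionKangarooTowers_of_e1TopDeltaHeavy`)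
and, uniformly, `E1TopDeltaHeavy → NoTowerWild n P` for every future wild class (`noTowerWild_of_e1TopDeltaHeavy`).
The converse direction would be «termination ⟹ resolution» — the programme itself; it is NOT claimed. -/

/-- In a forced tower the next marked point `x_{j+1}` is a NEAR POINT of `x_j`: `¬ NoNearPointOver (T.D j) (T.pt
j)`. [elementary] [folklore] -/
theorem tower_not_noNearPointOver (T : ForcedTower) (j : ℕ) : ¬ NoNearPointOver (T.D j) (T.pt j) := by
  intro h
  refine h (T.centre j) (T.St (j + 1)) (T.π j) (T.centre_support j) (T.centre_regular j) (T.isBlowup j)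
    (T.pt (j + 1)) (T.pt_map j) ?_
  rw [← T.transform_eq j]
  exact (T.isolated (j + 1)).1

/-- **KERNEL (PORT-FREE): NO STAGE OF A FORCED TOWER OVER BASE DATA IS δ-LIGHT** (weight `n ≥ 1`). [new] [folklore] -/
theorem tower_stage_not_deltaLightAt (T : ForcedTower) (g : T.St 0 ⟶ Spec (.of K)) (hB : IsBase (T.St 0) g) {n : ℕ}
    (hn : 1 ≤ n) (hD : IsDatum n (T.D 0)) (j : ℕ) : ¬ DeltaLightAt (T.D j).ideal n (T.pt j) := fun hl =>
  tower_not_noNearPointOver T j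
    (noNearPointOver_of_deltaLightAt (tower_isLocallyNoetherian_isRegular T g hB j).2 hn (T.D j)
      (tower_isDatum T g hB hD j).1 (T.isClosed_pt j) hl)

/-- no stage of a forced tower over base data is LIGHT (tree light law). [elementary] [folklore] -/
theorem tower_stage_not_lightAt (T : ForcedTower) (g : T.St 0 ⟶ Spec (.of K)) (hB : IsBase (T.St 0) g) {n : ℕ}
    (hn : 1 ≤ n) (hD : IsDatum n (T.D 0)) (j : ℕ) : ¬ LightAt (T.D j).ideal n (T.pt j) := fun hl =>
  tower_not_noNearPointOver T j
    (noNearPointOver_of_lightAt (tower_isLocallyNoetherian_isRegular T g hB j).2 hn (T.D j)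
      (tower_isDatum T g hB hD j).1 (T.isClosed_pt j) hl)

/-- no stage of a forced tower over base data is differentially SPLIT (tree twist law). [elementary] [folklore] -/
theorem tower_stage_not_diffSplitAt (T : ForcedTower) (g : T.St 0 ⟶ Spec (.of K)) (hB : IsBase (T.St 0) g) {n : ℕ}
    (hn : 1 ≤ n) (hD : IsDatum n (T.D 0)) (j : ℕ) : ¬ DiffSplitAt (T.D j).ideal n (T.pt j) := fun hs =>
  tower_not_noNearPointOver T j
    (noNearPointOver_of_diffSplitAt (tower_isLocallyNoetherian_isRegular T g hB j).2 hn (T.D j)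
      (tower_isDatum T g hB hD j).1 (T.isClosed_pt j) hs)

/-- **KERNEL (PORT-FREE): EVERY ABSOLUTELY CONTACT-FREE STAGE OF A FORCED TOWER OVER BASE DATA LIES IN THE δ-HEAVY
RESIDUAL LOCUS `TopDeltaHeavy`.** [new] [folklore] -/
theorem tower_stage_topDeltaHeavy (T : ForcedTower) (g : T.St 0 ⟶ Spec (.of K)) (hB : IsBase (T.St 0) g) {n : ℕ}
    (hn : 1 ≤ n) (hD : IsDatum n (T.D 0)) (j : ℕ) (hw : ¬ IsAbsContactAt (T.D j).ideal n (T.pt j)) :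
    TopDeltaHeavy (T.St j) (T.D j).ideal n :=
  ⟨T.pt j, T.isClosed_pt j, idealOrder_pt_eq_of_isDatum T j (tower_isDatum T g hB hD j), hw,
    tower_stage_not_diffSplitAt T g hB hn hD j, tower_stage_not_lightAt T g hB hn hD j,
    tower_stage_not_deltaLightAt T g hB hn hD j⟩

/-- the same for `p`-POWER towers (lens-4's wild letter `PPowerTower`, via the tree's
`not_isAbsContactAt_of_pPowerFormAt` and `charP_stalk_stage`): EVERY stage lies in `TopDeltaHeavy`. [new] [folklore] -/
theorem tower_stage_topDeltaHeavy_of_pPowerTower {p : ℕ} [Fact p.Prime] [CharP K p] (T : ForcedTower)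
    (g : T.St 0 ⟶ Spec (.of K)) (hB : IsBase (T.St 0) g) {n : ℕ} (hn : 1 ≤ n) (hD : IsDatum n (T.D 0))
    (hP : PPowerTower n T) (j : ℕ) : TopDeltaHeavy (T.St j) (T.D j).ideal n := by
  haveI := charP_stalk_stage (p := p) T g j
  exact tower_stage_topDeltaHeavy T g hB hn hD j
    (not_isAbsContactAt_of_pPowerFormAt (p := p) (show 0 < n by omega) (hP j p Fact.out inferInstance))

/-- **KERNEL (PORT-FREE, HYPOTHESIS-FREE): THE δ-LIGHT COLUMN OF EVERY TOWER CLASS IS EMPTY** — no forced tower over base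
data of ANY class `P` (weight `n ≥ 1`) has a δ-light stage. [new] [folklore] -/
theorem noTowerWild_deltaLight_holds {n : ℕ} (hn : 1 ≤ n) (P : ForcedTower → Prop) :
    NoTowerWild n fun T => P T ∧ ∃ j, DeltaLightAt (T.D j).ideal n (T.pt j) := by
  intro p hp hpn k _ _ T g hB hD _ hT
  obtain ⟨j, hj⟩ := hT.2
  exact tower_stage_not_deltaLightAt T g hB hn hD j hj

/-- **KERNEL `↔` (EXACT, PORT-FREE): EVERY TOWER CLASS EQUALS ITS EVERYWHERE-δ-HEAVY PART** — lens-4's residual classes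
may assume for free that every stage is δ-heavy (so not split, not light, not δ-light): its towers run inside this
column's residual locus. [new] [folklore] -/
theorem noTowerWild_iff_deltaHeavy {n : ℕ} (hn : 1 ≤ n) (P : ForcedTower → Prop) :
    NoTowerWild n P ↔ NoTowerWild n fun T => P T ∧ ∀ j, ¬ DeltaLightAt (T.D j).ideal n (T.pt j) :=
  ⟨fun h p hp hpn k _ _ T g hB hD hE hT => h p hp hpn k T g hB hD hE hT.1,
    fun h p hp hpn k _ _ T g hB hD hE hT =>
      h p hp hpn k T g hB hD hE ⟨hT, fun j => tower_stage_not_deltaLightAt T g hB hn hD j⟩⟩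

/-- **KERNEL `→` (modulo the tree's port `TowerObstructs n`): THIS COLUMN'S RESIDUAL IMPLIES EVERY WILD (`p`-POWER) TOWER
RESIDUAL** — `WORTopDeltaHeavy n → NoTowerWild n P` for every class `P ≤ PPowerTower n`: the tower's root lies in
`TopDeltaHeavy`, the residual cell resolves its datum, the port forbids that. [new] [folklore] -/
theorem noTowerWild_of_worTopDeltaHeavy {n : ℕ} (hn : 1 ≤ n) (hT : TowerObstructs n) (h : WORTopDeltaHeavy n)
    (P : ForcedTower → Prop) (hP : ∀ T, P T → PPowerTower n T) : NoTowerWild n P := by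
  intro p hp hpn k _ _ T g hB hD _ hPT
  haveI : Fact p.Prime := ⟨hp⟩
  have hδ := tower_stage_topDeltaHeavy_of_pPowerTower (p := p) T g hB hn hD (hP T hPT) 0
  exact hT p hp k T g hB hD (h p hp k (T.St 0) g hB (T.D 0) hD (topHeavy_of_topDeltaHeavy hδ) hδ)

/-- the same for ABSOLUTELY CONTACT-FREE classes `P ≤ ContactFreeTower n` (lens-4's other wild letter). [new] [folklore] -/
theorem noTowerWild_of_worTopDeltaHeavy_contactFree {n : ℕ} (hn : 1 ≤ n) (hT : TowerObstructs n)
    (h : WORTopDeltaHeavy n) (P : ForcedTower → Prop) (hP : ∀ T, P T → ContactFreeTower n T) : NoTowerWild n P := by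
  intro p hp hpn k _ _ T g hB hD _ hPT
  have hδ := tower_stage_topDeltaHeavy T g hB hn hD 0 (hP T hPT 0)
  exact hT p hp k T g hB hD (h p hp k (T.St 0) g hB (T.D 0) hD (topHeavy_of_topDeltaHeavy hδ) hδ)

/-- **BY NAME: lens-4's CURRENT located residual at weight `n`** (tree `HistoryCutCells`) from this column's residual
cell, modulo the port. [new] [folklore] -/
theorem wildFreshJumpShallowCompanionKangarooTowersTerminate_of_worTopDeltaHeavy {n : ℕ} (hn : 1 ≤ n)
    (hT : TowerObstructs n) (h : WORTopDeltaHeavy n) : WildFreshJumpShallowCompanionKangarooTowersTerminate n :=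
  noTowerWild_of_worTopDeltaHeavy hn hT h _ fun _ hPT => hPT.1.1.1.1.2

/-- **BY NAME (families): `E1TopDeltaHeavy → NoWildFreshJumpShallowCompanionKangarooTowers`**, modulo the ports
`TowerObstructs n` (`n ≥ 1`). [new] [folklore] -/
theorem noWildFreshJumpShallowCompanionKangarooTowers_of_e1TopDeltaHeavy (hT : ∀ n, 1 ≤ n → TowerObstructs n)
    (h : E1TopDeltaHeavy) : NoWildFreshJumpShallowCompanionKangarooTowers := fun n hn =>
  wildFreshJumpShallowCompanionKangarooTowersTerminate_of_worTopDeltaHeavy hn (hT n hn) (h n hn)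

/-- **UNIFORM version for every present and future wild class of lens-4** (`P ≤ PPowerTower n`): `E1TopDeltaHeavy →
NoTowerWild n P`, modulo the port. [new] [folklore] -/
theorem noTowerWild_of_e1TopDeltaHeavy (hT : ∀ n, 1 ≤ n → TowerObstructs n) (h : E1TopDeltaHeavy) {n : ℕ}
    (hn : 1 ≤ n) (P : ForcedTower → Prop) (hP : ∀ T, P T → PPowerTower n T) : NoTowerWild n P :=
  noTowerWild_of_worTopDeltaHeavy hn (hT n hn) (h n hn) P hP

/-- the ports of all weights from the tree's single port `TowerObstructsAll`. [elementary] [folklore] -/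
theorem towerObstructs_of_towerObstructsAll (hT : ContactShadowClasses.TowerObstructsAll) (n : ℕ) : TowerObstructs n :=
  fun p hp k _ _ T g hB _ => hT p hp k T g hB

end Junction

end Summit.ResolutionOfSingularities.ResolutionOfSingularities.Theorems.DeltaCutClasses
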